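import Literature.NumberTheory.Automorphic.Liu2021.AppendixC.EtaleBettiComparison
import Literature.NumberTheory.Automorphic.Liu2021.AppendixC.BettiPinningTransport
import Literature.NumberTheory.Automorphic.Liu2021.AppendixC.RestOneLevelInvariants
import Literature.AlgebraicGeometry.HodgeTheory.HodgeTypeProjectors
import Literature.AlgebraicGeometry.HodgeTheory.HodgeTypeExteriorProduct
import Literature.AlgebraicGeometry.HodgeTheory.HodgeGroupTwistedHodgeOperators
import Literature.AlgebraicGeometry.HodgeTheory.ComplexConjugationHolds
import Literature.AlgebraicGeometry.HodgeTheory.HodgeTypeConjugation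
import Literature.AlgebraicGeometry.HodgeTheory.WeilSurfaceCMSquare
import Literature.AlgebraicGeometry.Motives.AbelianVarietyProjective
import Literature.AlgebraicGeometry.Motives.AbelianVarietyProjectiveChart
import HarnessLib

/-!
# The HODGE SPLIT `H¹ = H^{1,0} ⊕ H^{0,1}` of a pinned Betti tower `H¹_{B,τ'}(A_∞, ℂ) = colim_K H¹((A_K ×_{τ'} ℂ)(ℂ); ℂ)`:
# a `𝔾(𝔸_F^∞)`-equivariant type projector on `H`, and the ISOTYPIC SPLIT LEMMA («a `G`-type that does not occur in the
# holomorphic (resp. antiholomorphic) forms has its classes of type `(0,1)` (resp. `(1,0)`)»)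

Topic `NumberTheory/Automorphic/Liu2021/AppendixC`; namespace `Literature.NumberTheory.Automorphic.Liu2021.AppendixC`, dot-notation on
`B : C.BettiPinning T τ' H rhoB` (`EtaleBettiComparison.lean` §4).  KERNEL ONLY: theorems, NO definition, NO named fact, NO instance,
NO `sorry`.  Generic over every §4.2 datum `C : Sec42Data P5 isotropicAt`, translates `T`, embedding `τ'` and pinning `B`.

* §1 (pure Hodge theory) `HodgeModel.typeProj_map_eq` — the type projectors of `Hᵏ(X(ℂ);ℂ)` COMMUTE with pull-back along any morphism of
  smooth projective complex varieties (`π_{(p,q)}(f^* c) = f^*(π_{(p,q)} c)`: ★ `IsOfHodgeType.map_of_isSmoothProjective` + uniqueness of the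
  type decomposition ★ `typeProj_eq_of_sum_eq`; the argument of ★ `IsOfHodgeType.of_map_of_injective`, isolated).
* §2 (pure Hodge theory) `map_hodge_split_one` — pull-back respects the degree-one split `c = c₁₀ + c₀₁` (★
  `exists_add_eq_of_isOfHodgeType_one`, ★ `eq_zero_of_isOfHodgeType_one_zero_of_zero_one`, ★ `IsOfHodgeType.sub`);
  §3 the levels `(A_K ×_{τ'} ℂ)` are smooth projective of dimension `dim A_K` (★ `AbelianVariety.isSmoothProjective_holds`, ★
  `dim_baseChange`) and `bettiPullAlong τ' f` IS `complexBetti.map` of `f ×_{τ'} ℂ` (`rfl`).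
* §4 **`BettiPinning.exists_hodgeProjector`**: there is a `ℂ`-linear `Π : H → H`, EQUIVARIANT for `rhoB` (`b_hecke`: the Hecke action is
  pull-back along the algebraic `Alb(T_g)`), with `Π (b_K y) = b_K y` for `y` of type `(1,0)`, `Π (b_K y) = 0` for `y` of type `(0,1)`, and
  `Π (b_K y) = b_K y₁₀` on the split of §2 (well defined on `H = ⋃_K b_K(H¹(A_K))` by `exhaust`, `b_injective`, `b_one` and the directedness of
  the small levels ★ `C5.SmallLevel.exists_le_le`).
* §5 **`BettiPinning.isOfHodgeType_of_mem_isotypic`** (the ISOTYPIC SPLIT LEMMA): for any `ℂ[G]`-module `ω`, any target `(X, ρX)` with two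
  sub-`ℂ`-modules `Ωhol, Ωanti ≤ X`, and any injective `G`-equivariant `r : H → X` carrying the level classes of type `(1,0)` into `Ωanti` and those
  of type `(0,1)` into `Ωhol` (the REVERSED split of a conjugate fibre — or the straight one, the lemma is symmetric in the two names): if
  `b_K y` lies in the `ω`-isotypic part `⨆_ψ range ψ` of `H` and NO non-zero `G`-map `ω → X` takes values in `Ωhol`, then `y` is of type `(1,0)`;
  dually with `Ωanti` and `(0,1)`.

Consumer: cell hodgecm-mathlib, line `Cruxes/HLiu418/Lines/F0_AlbCm`, stub `stub_S1b_hodge : S1bHodgeShape` = §5 at `ω := ω⋆_lab`, `X :=` the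
adelic functions on `U(J⋆)(𝔸)`, `Ωhol := holCotForms₂ …`, `Ωanti :=` its conjugate (A-p01 (g12) M2), `r :=` the realisation (S1-R, reversed
type split), and the «no occurrence» inputs = the SIGNED EXCLUSION letter [Liu2021, Rem. D.5] (F0P5-p04 `S1bHODGE-STEP2-tokens` §2).
HC_CM is proved only modulo the printed citations until rung 0 closes; nothing of [Liu2021] is asserted here.

## References
* [Liu2021] Y. Liu, Camb. J. Math. 9 (2021) = arXiv:2102.11518: §4.2 l. 2070–2081 (the tower and its Hecke action), App. D (D.1) p. 128
  (Matsushima: `H¹_B = ⊕_π m(π) H¹(𝔤,K;π_∞) ⊗ π^∞`), Rem. D.5 p. 131, proof of Thm. D.6 (1) p. 140 («`H¹_B(X,ℂ)[π^∞]` has Hodge type `(1,0)`»).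
* [VoisinHodgeI2002] C. Voisin, *Hodge Theory and Complex Algebraic Geometry I*, §6.1.3 Cor. 6.14, §7.1.1, §7.3.2 (types and pull-backs).
-/

set_option autoImplicit false

noncomputable section

open CategoryTheory NumberField
open Literature.AlgebraicGeometry.Motives (AbelianVariety IsSmoothProjective)
open Literature.AlgebraicGeometry.HodgeTheory

/-! ## §1 Type projectors commute with pull-backs (pure Hodge theory) -/

namespace Literature.AlgebraicGeometry.HodgeTheory.HodgeModel

variable {m n : ℕ} {Y X : Literature.AlgebraicGeometry.Motives.SchemeOver ℂ}

/-- **`π_{(p,q)}(f^* c) = f^*(π_{(p,q)} c)`**: the Hodge-type projectors of smooth projective complex varieties commute with pull-back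
along any morphism `f : Y ⟶ X` (pull-backs preserve types, ★ `IsOfHodgeType.map_of_isSmoothProjective`, and the type decomposition is
unique, ★ `typeProj_eq_of_sum_eq`). [cite: VoisinHodgeI2002, §6.1.3 Cor. 6.14 and §7.3.2] -/
theorem typeProj_map_eq (hY : IsSmoothProjective m Y) (hX : IsSmoothProjective n X) (AY : HodgeModel m Y) (AX : HodgeModel n X)
    (f : Y ⟶ X) {k : ℕ} (pq : ↥(Finset.HasAntidiagonal.antidiagonal k)) (c : complexBetti X k) :
    AY.typeProj k pq (complexBetti.map f k c) = complexBetti.map f k (AX.typeProj k pq c) := by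
  have hmem : ∀ t, complexBetti.map f k (AX.typeProj k t c) ∈ AY.typePiece k t := fun t ↦
    (AY.mem_typePiece_iff_isOfHodgeType' hY t _).2
      (((AX.mem_typePiece_iff_isOfHodgeType' hX t _).1 (AX.typeProj_mem k t c)).map_of_isSmoothProjective hY hX f)
  have hsum : ∑ t, complexBetti.map f k (AX.typeProj k t c) = complexBetti.map f k c := by
    rw [← map_sum, AX.sum_typeProj]
  exact AY.typeProj_eq_of_sum_eq hmem hsum pq

end Literature.AlgebraicGeometry.HodgeTheory.HodgeModel

/-! ## §2 Degree one: pull-back respects the split `c = c₁₀ + c₀₁` (pure Hodge theory) -/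

namespace Literature.AlgebraicGeometry.HodgeTheory

variable {m n : ℕ} {Y X : Literature.AlgebraicGeometry.Motives.SchemeOver ℂ}

/-- **Pull-back respects the degree-one split**: if `c = c₁₀ + c₀₁` and `f^* c = d₁₀ + d₀₁` are Hodge splits (★
`exists_add_eq_of_isOfHodgeType_one`) then `f^* c₁₀ = d₁₀` and `f^* c₀₁ = d₀₁` — types are preserved (★
`IsOfHodgeType.map_of_isSmoothProjective`) and the split is unique (★ `eq_zero_of_isOfHodgeType_one_zero_of_zero_one`).
[cite: VoisinHodgeI2002, §6.1.3 Cor. 6.14 and §7.3.2] -/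
theorem map_hodge_split_one (hY : IsSmoothProjective m Y) (hX : IsSmoothProjective n X) (f : Y ⟶ X)
    {c c₁₀ c₀₁ : complexBetti X 1} (hc : c₁₀ + c₀₁ = c) (h10 : IsOfHodgeType n X 1 1 0 c₁₀) (h01 : IsOfHodgeType n X 1 0 1 c₀₁)
    {d₁₀ d₀₁ : complexBetti Y 1} (hd : d₁₀ + d₀₁ = complexBetti.map f 1 c) (hd10 : IsOfHodgeType m Y 1 1 0 d₁₀)
    (hd01 : IsOfHodgeType m Y 1 0 1 d₀₁) :
    complexBetti.map f 1 c₁₀ = d₁₀ ∧ complexBetti.map f 1 c₀₁ = d₀₁ := by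
  have p10 : IsOfHodgeType m Y 1 1 0 (complexBetti.map f 1 c₁₀) := h10.map_of_isSmoothProjective hY hX f
  have p01 : IsOfHodgeType m Y 1 0 1 (complexBetti.map f 1 c₀₁) := h01.map_of_isSmoothProjective hY hX f
  have hsum : complexBetti.map f 1 c₁₀ + complexBetti.map f 1 c₀₁ = d₁₀ + d₀₁ := by rw [← map_add, hc, hd]
  have hdiff : complexBetti.map f 1 c₁₀ - d₁₀ = d₀₁ - complexBetti.map f 1 c₀₁ := by
    rw [sub_eq_sub_iff_add_eq_add, hsum, add_comm]
  have t10 : IsOfHodgeType m Y 1 1 0 (complexBetti.map f 1 c₁₀ - d₁₀) := p10.sub hY hd10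
  have t01 : IsOfHodgeType m Y 1 0 1 (complexBetti.map f 1 c₁₀ - d₁₀) := by
    rw [hdiff]; exact hd01.sub hY p01
  have e1 : complexBetti.map f 1 c₁₀ = d₁₀ := sub_eq_zero.1 (eq_zero_of_isOfHodgeType_one_zero_of_zero_one hY t10 t01)
  refine ⟨e1, ?_⟩
  rw [e1] at hsum
  exact add_left_cancel hsum

/-- **The degree-one split is unique**: `c₁₀ + c₀₁ = d₁₀ + d₀₁` with the indicated types forces `c₁₀ = d₁₀` and `c₀₁ = d₀₁`.
[cite: VoisinHodgeI2002, §6.1.3 Cor. 6.14] -/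
theorem hodge_split_one_unique (hX : IsSmoothProjective n X) {c₁₀ c₀₁ d₁₀ d₀₁ : complexBetti X 1} (h : c₁₀ + c₀₁ = d₁₀ + d₀₁)
    (hc10 : IsOfHodgeType n X 1 1 0 c₁₀) (hc01 : IsOfHodgeType n X 1 0 1 c₀₁) (hd10 : IsOfHodgeType n X 1 1 0 d₁₀)
    (hd01 : IsOfHodgeType n X 1 0 1 d₀₁) : c₁₀ = d₁₀ ∧ c₀₁ = d₀₁ := by
  have hdiff : c₁₀ - d₁₀ = d₀₁ - c₀₁ := by rw [sub_eq_sub_iff_add_eq_add, h, add_comm]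
  have t10 : IsOfHodgeType n X 1 1 0 (c₁₀ - d₁₀) := hc10.sub hX hd10
  have t01 : IsOfHodgeType n X 1 0 1 (c₁₀ - d₁₀) := by rw [hdiff]; exact hd01.sub hX hc01
  have e1 : c₁₀ = d₁₀ := sub_eq_zero.1 (eq_zero_of_isOfHodgeType_one_zero_of_zero_one hX t10 t01)
  refine ⟨e1, ?_⟩
  rw [e1] at h
  exact add_left_cancel h

end Literature.AlgebraicGeometry.HodgeTheory

namespace Literature.NumberTheory.Automorphic.Liu2021.AppendixC

/-! ## §3 The levels of the tower: smooth projective; `bettiPullAlong = complexBetti.map` -/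

section Levels

variable {E : Type} [Field E]

/-- `(A ×_E ℂ)` (any `E`-algebra structure on `ℂ`) is smooth projective of dimension `dim A`.
[cite: MumfordAV1970, §4 (ii) and §6 Application 1 (p. 62)] -/
theorem isSmoothProjective_baseChange_complex (A : AbelianVariety E) [Algebra E ℂ] :
    IsSmoothProjective A.dim (A.baseChange ℂ).X := by
  have h : (A.baseChange ℂ).isSmoothProjective := AbelianVariety.isSmoothProjective_holds
  unfold AbelianVariety.isSmoothProjective at h
  rwa [AbelianVariety.dim_baseChange] at h

/-- `bettiPullAlong τ' f` is the pull-back `complexBetti.map` along `f ×_{τ'} ℂ` (unfolding). [cite: Liu2021, §4.2 l. 2070–2079] -/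
theorem bettiPullAlong_eq_map (τ' : E →+* ℂ) {A B : AbelianVariety E} (f : A ⟶ B) (y : bettiH1Along B τ') :
    bettiPullAlong τ' f y =
      letI : Algebra E ℂ := algebraAlong E τ'
      complexBetti.map (AbelianVariety.Hom.baseChange ℂ f).hom.hom.hom 1 y :=
  rfl

end Levels

/-! ## §4 The equivariant Hodge projector on a pinned Betti tower -/

namespace Sec42Data.BettiPinning

variable {F E : Type} [Field F] [NumberField F] [IsTotallyReal F] [Field E] [NumberField E] [Algebra F E]
  [IsTotallyComplex E] [Algebra.IsQuadraticExtension F E]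
variable {P5 : PropC5Data F E} {isotropicAt : ℕ → Prop}
variable {C : Sec42Data P5 isotropicAt} {T : C.HeckeTranslates} {τ' : E →+* ℂ} {H : Type} [AddCommGroup H] [Module ℂ H]
  {rhoB : Representation ℂ C.G H}

/-- Transition compatibility of a pinning along the functorial `Alb_u` (`b_{K'} = b_K ∘ Alb_u^*` for `K ≤ K'`): ★ `b_one` + ★ `albTr_one`.
[cite: Liu2021, §4.2 l. 2070–2079] -/
theorem b_Atr (B : C.BettiPinning T τ' H rhoB) {K K' : C5.SmallLevel C.S.K₀} (f : K ⟶ K') (y : C.bettiH1 τ' K') :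
    B.b K' y = B.b K (bettiPullAlong τ' (C.Atr f) y) := by
  rw [← T.albTr_one f]
  exact B.b_one K K' (C5.HeckeLE.one_of_le f.le) y

/-- **The `(1,0)`-projector of a pinned Betti tower.**  There is a `ℂ`-linear `Π : H → H`, EQUIVARIANT for the Hecke action `rhoB` (which is
pull-back along the algebraic translates `Alb(T_g)`, `b_hecke`), which on every level class `b_K y` returns `b_K y₁₀` for the Hodge split
`y = y₁₀ + y₀₁` of `y` on `A_K ×_{τ'} ℂ` (types `(1,0)`, `(0,1)`); in particular `proj` fixes the classes of type `(1,0)` and kills those of type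
`(0,1)`.  Well defined on `H = ⋃_K b_K(H¹_{B,τ'}(A_K, ℂ))` because pull-back along the transitions and translates respects the split (§2).
[cite: Liu2021, §4.2 l. 2070–2081; proof of Thm. D.6 (1) p. 140] [cite: VoisinHodgeI2002, §6.1.3 Cor. 6.14 and §7.3.2] -/
theorem exists_hodgeProjector (B : C.BettiPinning T τ' H rhoB) :
    letI : Algebra E ℂ := algebraAlong E τ'
    ∃ proj : H →ₗ[ℂ] H,
      (∀ g : C.G, proj ∘ₗ rhoB g = rhoB g ∘ₗ proj) ∧
      (∀ (K : C5.SmallLevel C.S.K₀) (y : C.bettiH1 τ' K),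
        ∃ y₁₀ y₀₁ : C.bettiH1 τ' K, y₁₀ + y₀₁ = y ∧ IsOfHodgeType (C.A K).dim ((C.A K).baseChange ℂ).X 1 1 0 y₁₀ ∧
          IsOfHodgeType (C.A K).dim ((C.A K).baseChange ℂ).X 1 0 1 y₀₁ ∧ proj (B.b K y) = B.b K y₁₀) ∧
      (∀ (K : C5.SmallLevel C.S.K₀) (y : C.bettiH1 τ' K), IsOfHodgeType (C.A K).dim ((C.A K).baseChange ℂ).X 1 1 0 y →
        proj (B.b K y) = B.b K y) ∧
      (∀ (K : C5.SmallLevel C.S.K₀) (y : C.bettiH1 τ' K), IsOfHodgeType (C.A K).dim ((C.A K).baseChange ℂ).X 1 0 1 y →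
        proj (B.b K y) = 0) := by
  letI : Algebra E ℂ := algebraAlong E τ'
  classical
  have hX : ∀ K : C5.SmallLevel C.S.K₀, IsSmoothProjective (C.A K).dim ((C.A K).baseChange ℂ).X := fun K =>
    isSmoothProjective_baseChange_complex (C.A K)
  -- the levelwise split `y = p K y + q K y`
  choose p q hpq hp hq using fun (K : C5.SmallLevel C.S.K₀) (y : C.bettiH1 τ' K) =>
    exists_add_eq_of_isOfHodgeType_one (hX K) y
  -- (a) the split commutes with pull-back along homomorphisms over `E` between levels
  have hnat : ∀ {K K' : C5.SmallLevel C.S.K₀} (φ : C.A K ⟶ C.A K') (y : C.bettiH1 τ' K'),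
      bettiPullAlong τ' φ (p K' y) = p K (bettiPullAlong τ' φ y) ∧ bettiPullAlong τ' φ (q K' y) = q K (bettiPullAlong τ' φ y) := by
    intro K K' φ y
    exact map_hodge_split_one (hX K) (hX K') (AbelianVariety.Hom.baseChange ℂ φ).hom.hom.hom (hpq K' y) (hp K' y) (hq K' y)
      (hpq K (bettiPullAlong τ' φ y)) (hp K _) (hq K _)
  -- (b) the split is additive and homogeneous at a fixed level
  have hadd : ∀ (K : C5.SmallLevel C.S.K₀) (y y' : C.bettiH1 τ' K), p K (y + y') = p K y + p K y' := by
    intro K y y'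
    have hs : (p K y + p K y') + (q K y + q K y') = p K (y + y') + q K (y + y') := by
      rw [hpq K (y + y'), add_add_add_comm, hpq K y, hpq K y']
    exact ((hodge_split_one_unique (hX K) hs ((hp K y).add (hX K) (hp K y')) ((hq K y).add (hX K) (hq K y'))
      (hp K _) (hq K _)).1).symm
  have hsmul : ∀ (K : C5.SmallLevel C.S.K₀) (t : ℂ) (y : C.bettiH1 τ' K), p K (t • y) = t • p K y := by
    intro K t y
    have hs : t • p K y + t • q K y = p K (t • y) + q K (t • y) := by rw [← smul_add, hpq K y, hpq K (t • y)]
    exact ((hodge_split_one_unique (hX K) hs ((hp K y).smul t) ((hq K y).smul t) (hp K _) (hq K _)).1).symm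
  -- (c) well-definedness on `H`: `b_K y = b_{K'} y'` ⇒ `b_K (p y) = b_{K'} (p y')`
  have hwd : ∀ {K K' : C5.SmallLevel C.S.K₀} (y : C.bettiH1 τ' K) (y' : C.bettiH1 τ' K'),
      B.b K y = B.b K' y' → B.b K (p K y) = B.b K' (p K' y') := by
    intro K K' y y' h
    obtain ⟨L, hLK, hLK'⟩ := C5.SmallLevel.exists_le_le K K'
    have e1 := B.b_Atr (homOfLE hLK) y
    have e2 := B.b_Atr (homOfLE hLK') y'
    have hz : bettiPullAlong τ' (C.Atr (homOfLE hLK)) y = bettiPullAlong τ' (C.Atr (homOfLE hLK')) y' :=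
      B.b_injective L (by rw [← e1, ← e2, h])
    rw [B.b_Atr (homOfLE hLK) (p K y), B.b_Atr (homOfLE hLK') (p K' y'), (hnat _ y).1, (hnat _ y').1, hz]
  -- (d) the projector as a function, through chosen representatives
  choose Kx yx hKy using B.exhaust
  let projf : H → H := fun x => B.b (Kx x) (p (Kx x) (yx x))
  have hprojb : ∀ (K : C5.SmallLevel C.S.K₀) (y : C.bettiH1 τ' K), projf (B.b K y) = B.b K (p K y) := fun K y =>
    hwd _ _ (hKy (B.b K y))
  -- (e) linearity
  have hprojadd : ∀ x x' : H, projf (x + x') = projf x + projf x' := by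
    intro x x'
    obtain ⟨K, y, rfl⟩ := B.exhaust x
    obtain ⟨K', y', rfl⟩ := B.exhaust x'
    obtain ⟨L, hLK, hLK'⟩ := C5.SmallLevel.exists_le_le K K'
    rw [B.b_Atr (homOfLE hLK) y, B.b_Atr (homOfLE hLK') y', ← map_add, hprojb, hprojb, hprojb, hadd, map_add]
  have hprojsmul : ∀ (t : ℂ) (x : H), projf (t • x) = t • projf x := by
    intro t x
    obtain ⟨K, y, rfl⟩ := B.exhaust x
    rw [← map_smul, hprojb, hprojb, hsmul, map_smul]
  let proj : H →ₗ[ℂ] H := { toFun := projf, map_add' := hprojadd, map_smul' := hprojsmul }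
  have hproj : ∀ (K : C5.SmallLevel C.S.K₀) (y : C.bettiH1 τ' K), proj (B.b K y) = B.b K (p K y) := hprojb
  refine ⟨proj, ?_, ?_, ?_, ?_⟩
  · -- equivariance: `rhoB g (b_{K'} y) = b_K (Alb(T_g)^* y)` and the split commutes with `Alb(T_g)^*`
    intro g
    apply LinearMap.ext
    intro x
    obtain ⟨K', y, rfl⟩ := B.exhaust x
    have hh := C5.heckeLE_heckeLevel g K'
    rw [LinearMap.comp_apply, LinearMap.comp_apply, B.b_hecke g _ K' hh y, hproj, hproj, B.b_hecke g _ K' hh (p K' y),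
      (hnat _ y).1]
  · intro K y
    exact ⟨p K y, q K y, hpq K y, hp K y, hq K y, hproj K y⟩
  · intro K y hy
    rw [hproj]
    have hs : y + 0 = p K y + q K y := by rw [add_zero, hpq]
    rw [← (hodge_split_one_unique (hX K) hs hy (IsOfHodgeType.zero (nonempty_hodgeModel_holds (hX K)).some 1 0 1)
      (hp K y) (hq K y)).1]
  · intro K y hy
    rw [hproj]
    have hs : 0 + y = p K y + q K y := by rw [zero_add, hpq]
    rw [← (hodge_split_one_unique (hX K) hs (IsOfHodgeType.zero (nonempty_hodgeModel_holds (hX K)).some 1 1 0) hy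
      (hp K y) (hq K y)).1, map_zero]

/-! ## §5 The isotypic split lemma -/

/-- **ISOTYPIC SPLIT LEMMA.**  Let `(H, rhoB)` be pinned by `B`, `ω` any `ℂ[G]`-module, `(X, ρX)` any target with two sub-`ℂ`-modules
`Ωhol, Ωanti ≤ X`, and `r : H → X` an injective `G`-equivariant `ℂ`-linear map carrying every level class of type `(1,0)` into `Ωanti` and
every level class of type `(0,1)` into `Ωhol`.  If `b_K y` lies in the `ω`-ISOTYPIC part `⨆_ψ range ψ` of `H` then:
(i) if no non-zero `G`-map `ω → X` takes all its values in `Ωhol`, `y` is of type `(1,0)`; (ii) if none takes all its values in `Ωanti`,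
`y` is of type `(0,1)`.  (Proof: `r ∘ (1 − Π)` resp. `r ∘ Π`, `Π` the projector of §4, is equivariant with values in `Ωhol` resp. `Ωanti`,
so it kills every `range ψ`, hence `b_K y`; `r`, `b_K` are injective.)  This is the algebra of «`H¹_B(X,ℂ)[π^∞]` has Hodge type `(1,0)`
when `π^{(0,1)} ⊗ π^∞` is not cuspidal» in the proof of [Liu2021, Thm. D.6 (1)]; the «no `G`-map» inputs are the automorphic letters.
[cite: Liu2021, proof of Thm. D.6 (1) p. 140 (l. 5625–5631); App. D (D.1) p. 128] -/
theorem isOfHodgeType_of_mem_isotypic (B : C.BettiPinning T τ' H rhoB) {W : Type} [AddCommGroup W] [Module ℂ W]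
    (ω : Representation ℂ C.G W) {X : Type} [AddCommGroup X] [Module ℂ X] (ρX : C.G → X →ₗ[ℂ] X)
    (Ωhol Ωanti : Submodule ℂ X) (r : H →ₗ[ℂ] X) (hr : Function.Injective r) (hrG : ∀ (g : C.G) (x : H), r (rhoB g x) = ρX g (r x))
    (K : C5.SmallLevel C.S.K₀) (y : C.bettiH1 τ' K)
    (hy : B.b K y ∈ ⨆ ψ : Representation.IntertwiningMap ω rhoB, LinearMap.range ψ.toLinearMap) :
    letI : Algebra E ℂ := algebraAlong E τ'
    (∀ (L : C5.SmallLevel C.S.K₀) (z : C.bettiH1 τ' L),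
      (IsOfHodgeType (C.A L).dim ((C.A L).baseChange ℂ).X 1 1 0 z → r (B.b L z) ∈ Ωanti) ∧
      (IsOfHodgeType (C.A L).dim ((C.A L).baseChange ℂ).X 1 0 1 z → r (B.b L z) ∈ Ωhol)) →
    ((∀ ψ : W →ₗ[ℂ] X, (∀ (g : C.G) (w : W), ψ (ω g w) = ρX g (ψ w)) → (∀ w, ψ w ∈ Ωhol) → ψ = 0) →
        IsOfHodgeType (C.A K).dim ((C.A K).baseChange ℂ).X 1 1 0 y) ∧
    ((∀ ψ : W →ₗ[ℂ] X, (∀ (g : C.G) (w : W), ψ (ω g w) = ρX g (ψ w)) → (∀ w, ψ w ∈ Ωanti) → ψ = 0) →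
        IsOfHodgeType (C.A K).dim ((C.A K).baseChange ℂ).X 1 0 1 y) := by
  letI : Algebra E ℂ := algebraAlong E τ'
  intro hsplit
  obtain ⟨proj, hprojG, hprojsplit, hproj10, hproj01⟩ := B.exists_hodgeProjector
  obtain ⟨y₁₀, y₀₁, hys, hy10, hy01, hprojy⟩ := hprojsplit K y
  -- the two equivariant maps `r ∘ (1 − proj)` (values in `Ωhol`) and `r ∘ proj` (values in `Ωanti`)
  have hvals : ∀ x : H, r (x - proj x) ∈ Ωhol ∧ r (proj x) ∈ Ωanti := by
    intro x
    obtain ⟨L, z, rfl⟩ := B.exhaust x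
    obtain ⟨z₁₀, z₀₁, hzs, hz10, hz01, hprojz⟩ := hprojsplit L z
    rw [hprojz, ← map_sub]
    have hz' : z - z₁₀ = z₀₁ := by rw [← hzs]; abel
    rw [hz']
    exact ⟨(hsplit L z₀₁).2 hz01, (hsplit L z₁₀).1 hz10⟩
  have hG : ∀ (g : C.G) (x : H), proj (rhoB g x) = rhoB g (proj x) := fun g x => by
    have := LinearMap.congr_fun (hprojG g) x
    simpa only [LinearMap.comp_apply] using this
  -- an equivariant `Φ : H → X` with values in `Ω` kills the isotypic part when no non-zero `G`-map `ω → X` lands in `Ω`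
  have hkill : ∀ (Φ : H →ₗ[ℂ] X) (Ω : Submodule ℂ X), (∀ (g : C.G) (x : H), Φ (rhoB g x) = ρX g (Φ x)) → (∀ x, Φ x ∈ Ω) →
      (∀ ψ : W →ₗ[ℂ] X, (∀ (g : C.G) (w : W), ψ (ω g w) = ρX g (ψ w)) → (∀ w, ψ w ∈ Ω) → ψ = 0) → Φ (B.b K y) = 0 := by
    intro Φ Ω hΦG hΦΩ hno
    have hle : (⨆ ψ : Representation.IntertwiningMap ω rhoB, LinearMap.range ψ.toLinearMap) ≤ LinearMap.ker Φ := by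
      refine iSup_le fun ψ => ?_
      rintro x ⟨w, rfl⟩
      have h0 : Φ ∘ₗ ψ.toLinearMap = 0 :=
        hno (Φ ∘ₗ ψ.toLinearMap) (fun g w => by
          rw [LinearMap.comp_apply, LinearMap.comp_apply, Representation.IntertwiningMap.toLinearMap_apply,
            ψ.isIntertwining, hΦG]
          rfl) (fun w => hΦΩ _)
      exact LinearMap.congr_fun h0 w
    exact hle hy
  refine ⟨fun hno => ?_, fun hno => ?_⟩
  · -- `r (b_K y - proj b_K y) = r (b_K y₀₁) = 0`, so `y₀₁ = 0` and `y = y₁₀`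
    have h0 := hkill (r ∘ₗ (LinearMap.id - proj)) Ωhol
      (fun g x => by rw [LinearMap.comp_apply, LinearMap.comp_apply, LinearMap.sub_apply, LinearMap.sub_apply,
        LinearMap.id_apply, LinearMap.id_apply, hG, ← map_sub, hrG])
      (fun x => by simpa only [LinearMap.comp_apply, LinearMap.sub_apply, LinearMap.id_apply] using (hvals x).1) hno
    have h1 : r (B.b K y₀₁) = 0 := by
      have : B.b K y - proj (B.b K y) = B.b K y₀₁ := by rw [hprojy, ← map_sub, ← hys]; abel_nf
      simpa only [LinearMap.comp_apply, LinearMap.sub_apply, LinearMap.id_apply, this] using h0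
    have h2 : y₀₁ = 0 := B.b_injective K (hr (by rw [h1, map_zero, map_zero]))
    rw [h2, add_zero] at hys
    rw [← hys]; exact hy10
  · have h0 := hkill (r ∘ₗ proj) Ωanti
      (fun g x => by rw [LinearMap.comp_apply, LinearMap.comp_apply, hG, hrG])
      (fun x => by simpa only [LinearMap.comp_apply] using (hvals x).2) hno
    have h1 : r (B.b K y₁₀) = 0 := by simpa only [LinearMap.comp_apply, hprojy] using h0
    have h2 : y₁₀ = 0 := B.b_injective K (hr (by rw [h1, map_zero, map_zero]))
    rw [h2, zero_add] at hys
    rw [← hys]; exact hy01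

end Sec42Data.BettiPinning

end Literature.NumberTheory.Automorphic.Liu2021.AppendixC

end
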